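import Literature.AlgebraicGeometry.HodgeTheory.ComplexConjugationDischarge
import Literature.AlgebraicGeometry.Motives.HodgeDecompositionIsInternalDischarge
import HarnessLib

/-!
# Every smooth projective complex variety has a real Hodge model (discharge of `exists_isReal_hodgeModel`)

Family `hodge`, layer `Literature/AlgebraicGeometry/HodgeTheory`. Theorems-only leaf companion of
`ComplexConjugation` (the named fact `exists_isReal_hodgeModel`: for every `n` and every smooth
projective `X/ℂ` of dimension `n` there is a Hodge model `A : HodgeModel n X` — Serre's
analytification `X^an`, a NATURAL complex de Rham isomorphism family over the manifolds charted on
`ℂⁿ`, and the Hodge decomposition of `H^k_dR(X^an; ℂ)` into the `K^{p,q}` — which `IsReal`: its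
de Rham family intertwines conjugation of forms with conjugation of cochain values), of
`ComplexConjugationProofs` (the assembly `exists_isReal_hodgeModel_of` from (3ℝ), (4a), (4b)) and of
`ComplexConjugationDischarge` ((3ℝ) discharged by de Rham's theorem, and
`exists_isReal_hodgeModel_of_hodgeDecomposition`: the fact from (4b) alone, (4a) being the theorem
`Motives.isKaehlerManifold_of_isAnalytification_of_isClosedImmersion_holds`).

The last input (4b), the Hodge decomposition of compact Kähler manifolds
(`Motives.isInternal_hodgePQ`; Voisin (2002), §6.1.3 Prop. 6.11), is now the theorem
`Motives.isInternal_hodgePQ_holds` (`Motives/HodgeDecompositionIsInternalDischarge`: Voisin's route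
Thm. 5.22 ⇒ 5.24 ⇒ 6.7 ⇒ 6.10 ⇒ 6.11 fed with Warner's Theorems 6.5/6.6 for `Δ_∂̄`, proved in
`Geometry/Kaehler/TorusDolbeault*`). Hence, with no hypothesis left:

* `exists_isReal_hodgeModel_holds` — **discharge of `exists_isReal_hodgeModel`**;
* `nonempty_hodgeModel_holds` — **discharge of the weaker companion fact `nonempty_hodgeModel n X`**
  of `HodgeModelExistence` (every smooth projective `X` has a Hodge model), read off the real model
  (equivalently, the tree's `nonempty_hodgeModel_of_hodgeDecomposition` fed
  `Motives.isInternal_hodgePQ_holds`).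

This file cannot be merged into `ComplexConjugation` (import cycle through
`ComplexConjugationProofs → … → DeRhamTheoremProofs`). No definition, no named fact (D-0026).

## References

* J.-P. Serre, *Géométrie algébrique et géométrie analytique*, Ann. Inst. Fourier 6 (1956), §2
  n°5 Prop. 2 (the analytification and its uniqueness), n°7 Prop. 6 (complete ⟺ compact).
  [SerreGAGA1956]
* C. Voisin, *Hodge Theory and Complex Algebraic Geometry I* (2002), §3.3.2 (Fubini–Study), §4.3.2
  Thm. 4.47 with Rem. 4.48 (de Rham), §6.1.3 Prop. 6.11 (Hodge decomposition), Cor. 6.12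
  (conjugation). [VoisinHodgeI2002]
* F. W. Warner, *Foundations of Differentiable Manifolds and Lie Groups*, GTM 94 (1983), Thms. 6.5,
  6.6, 6.11. [WarnerGTM94]
-/

noncomputable section

namespace Literature.AlgebraicGeometry.HodgeTheory

section HodgeTheory

/-- **Every smooth projective complex variety has a real Hodge model — discharge of the named fact
`exists_isReal_hodgeModel`** (Serre (1956), GAGA §2 n°5 Prop. 2 and n°7 Prop. 6: the
analytification `X^an`, a compact Hausdorff complex manifold; Voisin (2002), Thm. 4.47 with
Rem. 4.48 and Cor. 6.12: the de Rham isomorphism with complex coefficients is the complexification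
of the real one, hence natural and commuting with complex conjugation; Voisin (2002), §3.3.2: `X^an`
is Kähler (Fubini–Study); Voisin (2002), §6.1.3 Prop. 6.11: the Hodge decomposition of a compact
Kähler manifold). For every `n` and every smooth projective `X/ℂ` of dimension `n` there is a
Hodge model `A : HodgeModel n X` with `A.IsReal`. Proof: the assembly
`exists_isReal_hodgeModel_of_hodgeDecomposition` ((1) analytification, (3ℝ) the real complexified
de Rham family `exists_isReal_complexDeRhamIsoFamily_holds`, (4a)
`Motives.isKaehlerManifold_of_isAnalytification_of_isClosedImmersion_holds`, all proved upstream)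
fed with (4b) the Hodge decomposition `Motives.isInternal_hodgePQ_holds`. Relies on: nothing
unproved. [cite: SerreGAGA1956, §2 n°5 Prop. 2 and n°7 Prop. 6]
[cite: VoisinHodgeI2002, §4.3.2 Thm. 4.47, Rem. 4.48; §6.1.3 Prop. 6.11, Cor. 6.12] -/
theorem exists_isReal_hodgeModel_holds : exists_isReal_hodgeModel :=
  exists_isReal_hodgeModel_of_hodgeDecomposition fun _E _ _ _ _M _ _ _ ↦ Motives.isInternal_hodgePQ_holds

variable {n : ℕ} {X : Motives.SchemeOver ℂ}

/-- **Smooth projective complex varieties have Hodge models — discharge of the named fact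
`nonempty_hodgeModel n X`** of `HodgeModelExistence` (Serre (1956), GAGA §2: `X^an`; de Rham's
theorem; Voisin (2002), §3.3.2 and §6.1.3 Prop. 6.11: `X^an ⊂ ℙᴺ(ℂ)` is compact Kähler, Hodge
decomposition), for every `n` and `X` (the parameters of the fact): forget the reality of the model
of `exists_isReal_hodgeModel_holds`. (Equivalently `nonempty_hodgeModel_of_hodgeDecomposition` of
`MiddleDimensionReductionOfHodgeDecomposition` fed `Motives.isInternal_hodgePQ_holds`.) Relies on:
nothing unproved. [cite: SerreGAGA1956, §2 n°5 Prop. 2 and n°7 Prop. 6]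
[cite: VoisinHodgeI2002, §3.3.2 and §6.1.3 Prop. 6.11] -/
theorem nonempty_hodgeModel_holds : nonempty_hodgeModel n X :=
  fun hX ↦
    let ⟨A, _⟩ := exists_isReal_hodgeModel_holds n X hX
    ⟨A⟩

end HodgeTheory

end Literature.AlgebraicGeometry.HodgeTheory

end
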